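import Literature.AlgebraicGeometry.Resolution.QuadraticTransformsStructure
import Literature.AlgebraicGeometry.Resolution.InitialFormLinearFactors
import Literature.AlgebraicGeometry.Resolution.QuadraticTransformColength
import Literature.AlgebraicGeometry.Resolution.NearPointColengthDropScheme
import Mathlib.RingTheory.Ideal.MinimalPrime.Noetherian
import HarnessLib

/-!
# The weak transform of an ideal at a first quadratic transform, and the colength drop

Topic: `Literature/AlgebraicGeometry/Resolution`. Zariski–Samuel II, App. 5 and Huneke–Swanson
2006, §14.2–14.3: for a two-dimensional regular local ring `(R, 𝔪)` of the field `K` with regular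
system of parameters `𝔪 = (x, y)`, the chart ring `A = R[y/x] = R[𝔪/x] ⊆ K` of the blowing up
of the closed point and an ideal `J ⊆ 𝔪^r` of `R`, the **weak transform** of `J` on the chart is
`J^A = (JA : x^r)`, so that `JA = x^r · J^A`; at a quadratic transform `R₁ = A_Q ⊇ A` the extension
`J R₁` is principal iff `J^A R₁` is. PROVED (everything inside `K`, no new definitions beyond the
abbreviation `chartAdjoin`):

* `chartIncl_injective`, `map_maximalIdeal_chartIncl`, `exists_pow_mul_eq_chartIncl` — the chart
  `A = R[y/x]` (`chartAdjoin`) satisfies the hypotheses of `QuadraticTransformColength.lean`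
  (`R → A` injective, `𝔪A = xA`, every `s ∈ A` has `xⁿ s ∈ 𝔪ⁿ`);
* `map_eq_span_pow_mul_weakTransform` — `JA = x^r (JA : x^r)` for `J ⊆ 𝔪^r` (`weakTransformChart`);
  `isPrincipal_span_singleton_mul_iff` — in a domain `(a)·I` is principal iff `I` is (`a ≠ 0`);
  `extIdeal` (extension of an ideal of `R` to an over-ring in `K`), `isPrincipal_extIdeal_iff` —
  for `A ⊆ R' ⊆ K`: `J R'` is principal iff `(JA : x^r) R'` is;
* `weakTransform_not_le_span` — **the order argument**: if `ord J = r` then `(JA : x^r) ⊄ xA`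
  (`𝔪^{r+1}` is contracted from `A`, `comap_map_pow_maximalIdeal`);
* `ringKrullDim_chartAdjoin_le` — `dim A ≤ 2`; `finite_setOf_isQuadraticTransform_not_isPrincipal`
  — **only finitely many quadratic transforms `R₁` of `R` have `J R₁` non-principal**: such an
  `R₁` lies in the chart of `x` or of `y`, where it is `A_Q` for a prime `Q ⊇ (JA : x^r) + xA`
  which is minimal over that ideal (no prime lies strictly between `xA` and `Q`, `dim A ≤ 2`), and
  minimal primes over an ideal of a Noetherian ring are finitely many;
* `length_quotient_weakTransform_map_lt` — **the colength drops** (Huneke–Swanson Lemma 14.3.4,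
  `length_quotient_transform_lt_of_not_mem`, followed by localisation): at `R₁ = A_Q`,
  `λ_{R₁}(R₁/(JA : x^r)R₁) < λ_R(R/J)` provided some `f ∈ J` of order `r` has `f ∉ (x) + 𝔪^{r+1}`.

## References

* O. Zariski, P. Samuel, *Commutative Algebra* II (1960), Appendix 5. [ZariskiSamuel1960]
* C. Huneke, I. Swanson, *Integral Closure of Ideals, Rings, and Modules* (2006), §14.2 (p. 264),
  Lemma 14.3.4, Thm. 14.5.2 (proof). [HunekeSwanson2006]
-/

noncomputable section

open IsLocalRing Polynomial

namespace Literature.AlgebraicGeometry.Resolution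

universe u

variable {K : Type u} [Field K]

/-! ## Principal ideals times ideals in a domain -/

/-- **In a domain, `(a)·I` is principal iff `I` is** (`a ≠ 0`). [folklore] -/
theorem isPrincipal_span_singleton_mul_iff {D : Type*} [CommRing D] [IsDomain D] {a : D}
    (ha : a ≠ 0) (I : Ideal D) : (Ideal.span {a} * I).IsPrincipal ↔ I.IsPrincipal := by
  constructor
  · rintro ⟨g, hg⟩
    -- `g = a c` with `c ∈ I`, and `I = (c)`
    have hgmem : g ∈ Ideal.span {a} * I := by rw [hg]; exact Ideal.mem_span_singleton_self g
    obtain ⟨c, hc, hac⟩ := Ideal.mem_span_singleton_mul.mp hgmem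
    refine ⟨⟨c, le_antisymm (fun i hi => ?_) ((Ideal.span_singleton_le_iff_mem _).mpr hc)⟩⟩
    have hai : a * i ∈ Ideal.span {a} * I := Ideal.mul_mem_mul (Ideal.mem_span_singleton_self a) hi
    rw [hg] at hai
    obtain ⟨d, hd⟩ := Ideal.mem_span_singleton'.mp hai
    rw [← hac] at hd
    refine Ideal.mem_span_singleton'.mpr ⟨d, mul_left_cancel₀ ha ?_⟩
    rw [← hd]; ring
  · rintro ⟨c, hc⟩
    refine ⟨⟨a * c, ?_⟩⟩
    rw [hc, Ideal.submodule_span_eq, Ideal.span_singleton_mul_span_singleton]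

/-- An ideal contained in `(a)` is `(a)` times its colon by `a`. [folklore] -/
theorem eq_span_singleton_mul_colon {D : Type*} [CommRing D] {a : D} {N : Ideal D}
    (h : N ≤ Ideal.span {a}) : N = Ideal.span {a} * N.colon {a} := by
  apply le_antisymm
  · intro n hn
    obtain ⟨c, rfl⟩ := Ideal.mem_span_singleton'.mp (h hn)
    rw [mul_comm c a]
    exact Ideal.mul_mem_mul (Ideal.mem_span_singleton_self a)
      (Submodule.mem_colon_singleton.mpr (show c • a ∈ N by rw [smul_eq_mul]; exact hn))
  · rw [Ideal.mul_le]
    intro b hb c hc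
    obtain ⟨d, rfl⟩ := Ideal.mem_span_singleton'.mp hb
    have hca : c * a ∈ N := by
      have := Submodule.mem_colon_singleton.mp hc
      rwa [smul_eq_mul] at this
    have e : d * a * c = d * (c * a) := by ring
    rw [e]
    exact Ideal.mul_mem_left _ _ hca

/-! ## The chart `A = R[y/x]` of a two-dimensional regular local ring -/

section Chart

variable {R : Subring K} [IsLocalRing R] {x y : R}

/-- The chart ring `R[y/x] ⊆ K` (`= R[𝔪/x]` when `𝔪 = (x, y)`, `blowupRing_eq_adjoin`).
[cite: HunekeSwanson2006, §14.2 (p. 264)] -/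
abbrev chartAdjoin (x y : R) : Subring K :=
  (Algebra.adjoin R {((y : R) : K) / ((x : R) : K)}).toSubring

/-- `R ⊆ R[y/x]`. [folklore] -/
abbrev chartIncl (x y : R) : R →+* chartAdjoin x y :=
  Subring.inclusion (subring_le_adjoin R (((y : R) : K) / ((x : R) : K)))

omit [IsLocalRing R] in
/-- `R → R[y/x]` is injective. [folklore] -/
theorem chartIncl_injective (x y : R) : Function.Injective (chartIncl (K := K) x y) :=
  fun a b h => Subtype.ext (by
    have := congrArg (fun z : chartAdjoin (K := K) x y => (z : K)) h
    exact this)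

/-- **Every element `s` of `R[y/x]` has `xⁿ s ∈ 𝔪ⁿ` for some `n`** (write `s = F(y/x)` with
`deg F ≤ n`; then `xⁿ F(y/x) = Σ aᵢ yⁱ xⁿ⁻ⁱ`). [cite: HunekeSwanson2006, §14.2 (p. 264)] -/
theorem exists_pow_mul_eq_chartIncl (hm : maximalIdeal R = Ideal.span {x, y}) (hx0 : x ≠ 0)
    (s : chartAdjoin (K := K) x y) :
    ∃ (n : ℕ) (b : R), b ∈ maximalIdeal R ^ n ∧ chartIncl x y b = chartIncl x y x ^ n * s := by
  have hx0K : ((x : R) : K) ≠ 0 := fun e => hx0 (Subtype.ext e)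
  have hxm : x ∈ maximalIdeal R := hm ▸ Ideal.subset_span (by simp)
  have hym : y ∈ maximalIdeal R := hm ▸ Ideal.subset_span (by simp)
  obtain ⟨F, hF⟩ := exists_aeval_eq_of_mem_adjoin s.2
  set u : K := ((y : R) : K) / ((x : R) : K) with hu
  refine ⟨F.natDegree, ∑ i ∈ Finset.range (F.natDegree + 1), F.coeff i * y ^ i * x ^ (F.natDegree - i),
    ?_, Subtype.ext ?_⟩
  · refine Ideal.sum_mem _ fun i hi => ?_
    have hi' := Finset.mem_range.mp hi
    have h1 : y ^ i * x ^ (F.natDegree - i) ∈ maximalIdeal R ^ F.natDegree := by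
      have := Ideal.mul_mem_mul (Ideal.pow_mem_pow hym i) (Ideal.pow_mem_pow hxm (F.natDegree - i))
      rwa [← pow_add, show i + (F.natDegree - i) = F.natDegree by omega] at this
    rw [mul_assoc]
    exact Ideal.mul_mem_left _ _ h1
  · change ((∑ i ∈ Finset.range (F.natDegree + 1), F.coeff i * y ^ i * x ^ (F.natDegree - i) : R) : K) =
      ((x : R) : K) ^ F.natDegree * (s : K)
    rw [← hF, Polynomial.aeval_eq_sum_range, AddSubmonoidClass.coe_finsetSum, Finset.mul_sum]
    refine Finset.sum_congr rfl fun i hi => ?_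
    have hi' := Finset.mem_range.mp hi
    rw [Subring.coe_mul, Subring.coe_mul, Subring.coe_pow, Subring.coe_pow, Algebra.smul_def,
      Algebra.algebraMap_ofSubsemiring_apply, hu, div_pow]
    have e : ((x : R) : K) ^ F.natDegree = ((x : R) : K) ^ i * ((x : R) : K) ^ (F.natDegree - i) := by
      rw [← pow_add, show i + (F.natDegree - i) = F.natDegree by omega]
    rw [e]
    field_simp

/-- `𝔪 R[y/x] = x R[y/x]` for `𝔪 = (x, y)`. [cite: HunekeSwanson2006, §14.2 (p. 264)] -/
theorem map_maximalIdeal_chartIncl (hm : maximalIdeal R = Ideal.span {x, y}) (hx0 : x ≠ 0) :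
    (maximalIdeal R).map (chartIncl (K := K) x y) = Ideal.span {chartIncl x y x} := by
  rw [hm]; exact map_incl_span_pair hx0 y

/-- `JA ⊆ (x^r)` for `J ⊆ 𝔪^r`. [folklore] -/
theorem map_chartIncl_le_span_pow (hm : maximalIdeal R = Ideal.span {x, y}) (hx0 : x ≠ 0)
    {J : Ideal R} {r : ℕ} (hJ : J ≤ maximalIdeal R ^ r) :
    J.map (chartIncl (K := K) x y) ≤ Ideal.span {chartIncl x y x ^ r} := by
  refine (Ideal.map_mono hJ).trans ?_
  rw [Ideal.map_pow, map_maximalIdeal_chartIncl hm hx0, Ideal.span_singleton_pow]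

/-- **The weak transform** `J^A = (JA : x^r)` of `J` on the chart `A = R[y/x]`.
[cite: HunekeSwanson2006, §14.3 (Lemma 14.3.4)] -/
abbrev weakTransformChart (x y : R) (J : Ideal R) (r : ℕ) : Ideal (chartAdjoin (K := K) x y) :=
  (J.map (chartIncl x y)).colon {chartIncl x y x ^ r}

/-- **`JA = x^r · (JA : x^r)`** for `J ⊆ 𝔪^r`. [cite: HunekeSwanson2006, §14.3 (Lemma 14.3.4)] -/
theorem map_eq_span_pow_mul_weakTransform (hm : maximalIdeal R = Ideal.span {x, y}) (hx0 : x ≠ 0)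
    {J : Ideal R} {r : ℕ} (hJ : J ≤ maximalIdeal R ^ r) :
    J.map (chartIncl (K := K) x y) =
      Ideal.span {chartIncl x y x ^ r} * weakTransformChart x y J r :=
  eq_span_singleton_mul_colon (map_chartIncl_le_span_pow hm hx0 hJ)

end Chart

/-! ## Extension of an ideal of `R` to an over-ring inside `K` -/

section Ext

variable {R : Subring K}

/-- The extension of an ideal `J` of `R` to a subring `R'` of `K` (meant for `R ⊆ R'`): the ideal
of `R'` generated by the elements of `J`. This is `J.map (Subring.inclusion h)` for `h : R ≤ R'`
(`extIdeal_eq_map`), but does not mention `h`. [folklore] -/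
def extIdeal (J : Ideal R) (R' : Subring K) : Ideal R' :=
  Ideal.span {z : R' | (z : K) ∈ ((↑) : R → K) '' (J : Set R)}

/-- `extIdeal J R' = J R'` for `R ⊆ R'`. [folklore] -/
theorem extIdeal_eq_map (J : Ideal R) {R' : Subring K} (h : R ≤ R') :
    extIdeal J R' = J.map (Subring.inclusion h) := by
  rw [extIdeal, Ideal.map]
  congr 1
  ext z
  simp only [Set.mem_setOf_eq, Set.mem_image, SetLike.mem_coe]
  constructor
  · rintro ⟨j, hj, hjz⟩
    exact ⟨j, hj, Subtype.ext hjz⟩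
  · rintro ⟨j, hj, rfl⟩
    exact ⟨j, hj, rfl⟩

/-- Extension is transitive: `(J R') R'' = J R''`. [folklore] -/
theorem map_extIdeal (J : Ideal R) {R' R'' : Subring K} (h : R ≤ R') (h' : R' ≤ R'') :
    (extIdeal J R').map (Subring.inclusion h') = extIdeal J R'' := by
  rw [extIdeal_eq_map J h, extIdeal_eq_map J (h.trans h'), Ideal.map_map]
  rfl

end Ext

/-! ## Principality of `J R'` versus the weak transform -/

section Principal

variable {R : Subring K} [IsLocalRing R] {x y : R}

/-- **For `A = R[y/x] ⊆ R' ⊆ K`: `J R'` is principal iff `(JA : x^r) R'` is** (`J R' = x^r · (JA : x^r)R'`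
in the domain `R'`). [cite: ZariskiSamuel1960, Appendix 5] -/
theorem isPrincipal_extIdeal_iff (hm : maximalIdeal R = Ideal.span {x, y}) (hx0 : x ≠ 0)
    {J : Ideal R} {r : ℕ} (hJ : J ≤ maximalIdeal R ^ r) {R' : Subring K}
    (hA : chartAdjoin (K := K) x y ≤ R') :
    (extIdeal J R').IsPrincipal ↔
      ((weakTransformChart x y J r).map (Subring.inclusion hA)).IsPrincipal := by
  have hRR' : R ≤ R' := (subring_le_adjoin R _).trans hA
  have hx0K : ((x : R) : K) ≠ 0 := fun e => hx0 (Subtype.ext e)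
  have hcomp : (Subring.inclusion hA).comp (chartIncl (K := K) x y) = Subring.inclusion hRR' :=
    RingHom.ext fun _ => rfl
  have e : extIdeal J R' = Ideal.span {Subring.inclusion hA (chartIncl x y x ^ r)} *
      (weakTransformChart x y J r).map (Subring.inclusion hA) := by
    rw [extIdeal_eq_map J hRR', ← hcomp, ← Ideal.map_map,
      map_eq_span_pow_mul_weakTransform hm hx0 hJ, Ideal.map_mul, Ideal.map_span,
      Set.image_singleton]
  rw [e]
  refine isPrincipal_span_singleton_mul_iff ?_ _
  intro h0
  have := congrArg (fun z : R' => (z : K)) h0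
  simp only [map_pow, Subring.coe_inclusion, Subring.coe_pow] at this
  exact pow_ne_zero r hx0K (by simpa using this)

end Principal

/-! ## The order argument: the weak transform is not divisible by `x` -/

section Order

variable {R : Subring K} [IsRegularLocalRing R] {x y : R}

/-- `x ∉ 𝔪²` for a regular system of parameters `(x, y)`. [folklore] -/
theorem fst_not_mem_sq (hdim : ringKrullDim R = 2) (hm : maximalIdeal R = Ideal.span {x, y}) :
    x ∉ maximalIdeal R ^ 2 := by
  have := add_mul_not_mem_sq hdim hm 0
  rwa [zero_mul, add_zero] at this

/-- **`(JA : x^r) ⊄ xA` when `J ⊄ 𝔪^{r+1}`** (the powers of `𝔪` are contracted from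
`A = R[y/x]`, `comap_map_pow_maximalIdeal`; else `J ⊆ x^{r+1}A ∩ R = 𝔪^{r+1}`).
[cite: HunekeSwanson2006, Lemma 14.3.4 (proof)] -/
theorem weakTransform_not_le_span (hdim : ringKrullDim R = 2)
    (hm : maximalIdeal R = Ideal.span {x, y}) (hx0 : x ≠ 0) {J : Ideal R} {r : ℕ}
    (hJ : J ≤ maximalIdeal R ^ r) (hJr : ¬ J ≤ maximalIdeal R ^ (r + 1)) :
    ¬ weakTransformChart (K := K) x y J r ≤ Ideal.span {chartIncl x y x} := by
  intro hle
  letI : Algebra R (chartAdjoin (K := K) x y) := (chartIncl x y).toAlgebra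
  have halg : algebraMap R (chartAdjoin (K := K) x y) = chartIncl x y := rfl
  have hxm : x ∈ maximalIdeal R := hm ▸ Ideal.subset_span (by simp)
  have hx2 := fst_not_mem_sq hdim hm
  have hmS : (maximalIdeal R).map (algebraMap R (chartAdjoin (K := K) x y)) =
      Ideal.span {algebraMap R _ x} := map_maximalIdeal_chartIncl hm hx0
  have hS2 := exists_pow_mul_eq_chartIncl (K := K) hm hx0
  apply hJr
  have h1 : J.map (chartIncl (K := K) x y) ≤ (maximalIdeal R ^ (r + 1)).map (chartIncl x y) := by
    rw [map_eq_span_pow_mul_weakTransform hm hx0 hJ, Ideal.map_pow, map_maximalIdeal_chartIncl hm hx0,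
      Ideal.span_singleton_pow, pow_succ, ← Ideal.span_singleton_mul_span_singleton]
    exact Ideal.mul_mono_right hle
  have h2 := Ideal.comap_mono (f := chartIncl (K := K) x y) h1
  rw [← halg, comap_map_pow_maximalIdeal hxm hx2 (chartIncl_injective x y) hmS hS2 (r + 1)] at h2
  exact Ideal.le_comap_map.trans h2

end Order


/-! ## `dim R[y/x] ≤ 2`; primes above the exceptional prime are incomparable -/

section Dimension

variable {R : Subring K} [IsLocalRing R] [IsNoetherianRing R] {x y : R}

omit [IsLocalRing R] in
/-- **`dim R[y/x] ≤ 2`** for a two-dimensional Noetherian local ring `R` of `K`: `R[y/x]` is a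
quotient of `R[X]/(xX − y)`, and `dim R[X] = 3` (Huneke–Swanson, proof of Thm. 14.5.2; cf.
`QuadraticTransformsProofs.exists_oneDim_between`). [cite: HunekeSwanson2006, Thm. 14.5.2 (proof)] -/
theorem ringKrullDim_chartAdjoin_le (hdim : ringKrullDim R = 2) (hx0 : x ≠ 0) :
    ringKrullDim (chartAdjoin (K := K) x y) ≤ 2 := by
  classical
  have hx0K : ((x : R) : K) ≠ 0 := fun e => hx0 (Subtype.ext e)
  set u : K := ((y : R) : K) / ((x : R) : K) with hu
  -- the surjection `R[X] → R[y/x]` killing `p₀ = xX - y`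
  set ψ := (aeval u).toRingHom.codRestrict (Algebra.adjoin R {u}).toSubring
    (fun _ => Polynomial.aeval_mem_adjoin_singleton R u) with hψdef
  have hψ : Function.Surjective ψ := aevalCod_surjective R u _
  set p₀ : R[X] := C x * X - C y with hp₀
  have hp₀u : aeval u p₀ = 0 := by
    rw [hp₀, map_sub, map_mul, aeval_C, aeval_X, aeval_C, hu]
    change ((x : R) : K) * ((y : K) / x) - (y : K) = 0
    field_simp
    ring
  have hp₀0 : p₀ ≠ 0 := by
    intro h
    have h1 : p₀.coeff 1 = x := by simp [hp₀, coeff_C]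
    rw [h, coeff_zero] at h1
    exact hx0 h1.symm
  have hkill : ∀ q ∈ Ideal.span {p₀}, ψ q = 0 := by
    intro q hq
    obtain ⟨c, rfl⟩ := Ideal.mem_span_singleton'.mp hq
    apply Subtype.ext
    change aeval u (c * p₀) = 0
    rw [map_mul, hp₀u, mul_zero]
  set g : R[X] ⧸ Ideal.span {p₀} →+* chartAdjoin (K := K) x y :=
    Ideal.Quotient.lift _ ψ hkill with hg
  have hgsurj : Function.Surjective g := by
    intro z
    obtain ⟨q, rfl⟩ := hψ z
    exact ⟨Ideal.Quotient.mk _ q, Ideal.Quotient.lift_mk _ _ _⟩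
  have h1 : ringKrullDim (chartAdjoin (K := K) x y) ≤ ringKrullDim (R[X] ⧸ Ideal.span {p₀}) :=
    ringKrullDim_le_of_surjective g hgsurj
  have h2 : ringKrullDim (R[X] ⧸ Ideal.span {p₀}) + 1 ≤ ringKrullDim R[X] :=
    ringKrullDim_quotient_succ_le_of_nonZeroDivisor (mem_nonZeroDivisors_of_ne_zero hp₀0)
  rw [Polynomial.ringKrullDim_of_isNoetherianRing, hdim] at h2
  exact h1.trans (ENat.WithBot.add_le_add_one_right_iff.mp h2)

omit [IsLocalRing R] in
/-- **No prime of `R[y/x]` lies strictly between the exceptional prime `xR[y/x]` and another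
prime** (`0 ⊊ (x) ⊊ P ⊊ Q` would be a chain of length `3 > dim R[y/x]`). [folklore] -/
theorem eq_of_span_lt_of_le (hdim : ringKrullDim R = 2) (hx0 : x ≠ 0)
    (hpx : (Ideal.span {chartIncl (K := K) x y x}).IsPrime)
    {P Q : Ideal (chartAdjoin (K := K) x y)} [P.IsPrime] [Q.IsPrime]
    (hP : Ideal.span {chartIncl (K := K) x y x} < P) (hPQ : P ≤ Q) : P = Q := by
  by_contra hne
  have hlt : P < Q := lt_of_le_of_ne hPQ hne
  have hx0K : ((x : R) : K) ≠ 0 := fun e => hx0 (Subtype.ext e)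
  haveI := hpx
  have hbot : (⊥ : Ideal (chartAdjoin (K := K) x y)) < Ideal.span {chartIncl (K := K) x y x} := by
    rw [bot_lt_iff_ne_bot, Ne, Ideal.span_singleton_eq_bot]
    intro h0
    exact hx0K (congrArg (fun s : chartAdjoin (K := K) x y => (s : K)) h0)
  have h1 := Ideal.height_add_one_le_of_lt_of_isPrime hbot
  have h2 := Ideal.height_add_one_le_of_lt_of_isPrime hP
  have h3 := Ideal.height_add_one_le_of_lt_of_isPrime hlt
  rw [Ideal.height_bot, zero_add] at h1
  have h4 : (3 : ℕ∞) ≤ Q.height := by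
    calc (3 : ℕ∞) = 1 + 1 + 1 := by norm_num
      _ ≤ (Ideal.span {chartIncl (K := K) x y x}).height + 1 + 1 := by gcongr
      _ ≤ P.height + 1 := by gcongr
      _ ≤ Q.height := h3
  have h5 : (Q.height : WithBot ℕ∞) ≤ 2 :=
    Ideal.height_le_ringKrullDim_of_isPrime.trans (ringKrullDim_chartAdjoin_le hdim hx0)
  have h6 : ((3 : ℕ∞) : WithBot ℕ∞) ≤ 2 := (WithBot.coe_le_coe.mpr h4).trans h5
  exact absurd (WithBot.coe_le_coe.mp h6) (by decide)

end Dimension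

/-! ## Only finitely many first quadratic transforms are base points of `J` -/

section Finite

variable {R : Subring K} [IsRegularLocalRing R] {x y : R}

/-- The quadratic transforms in the chart of `x` at which `J` is not principal come from minimal
primes over `(JA : x^r) + xA`. [cite: ZariskiSamuel1960, Appendix 5] -/
theorem exists_minimalPrime_of_not_isPrincipal (hdim : ringKrullDim R = 2)
    (hm : maximalIdeal R = Ideal.span {x, y}) (hx0 : x ≠ 0) (hpq : ∀ t, x ∣ y * t → x ∣ t)
    {J : Ideal R} {r : ℕ} (hJ : J ≤ maximalIdeal R ^ r) (hJr : ¬ J ≤ maximalIdeal R ^ (r + 1))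
    {R₁ : Subring K} (h₁ : IsQuadraticTransform R R₁) (hle : chartAdjoin (K := K) x y ≤ R₁)
    (hbad : ¬ (extIdeal J R₁).IsPrincipal) :
    ∃ Q ∈ (weakTransformChart (K := K) x y J r ⊔ Ideal.span {chartIncl x y x}).minimalPrimes,
      ∃ _ : Q.IsPrime, R₁ = (LocalSubring.ofPrime (chartAdjoin (K := K) x y) Q).toSubring := by
  haveI := h₁.isLocalRing
  have hxm : x ∈ maximalIdeal R := hm ▸ Ideal.subset_span (by simp)
  have hym : y ∈ maximalIdeal R := hm ▸ Ideal.subset_span (by simp)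
  set A := chartAdjoin (K := K) x y with hAdef
  set Q : Ideal A := (maximalIdeal R₁).comap (Subring.inclusion hle) with hQdef
  have hA : blowupRing R (x : K) = A := blowupRing_eq_adjoin hm
  have hR₁ : R₁ = (LocalSubring.ofPrime A Q).toSubring := h₁.eq_ofPrime_of_le hxm hx0 hA.le hle
  -- the exceptional prime `𝔭 = xA ≤ Q`
  haveI h𝔭 : (Ideal.span {chartIncl (K := K) x y x}).IsPrime := by
    rw [← map_maximalIdeal_chartIncl hm hx0]
    exact isPrime_map_incl (K := K) hx0 hpq hxm hym
  have h𝔭Q : Ideal.span {chartIncl (K := K) x y x} ≤ Q := by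
    rw [Ideal.span_singleton_le_iff_mem, hQdef, Ideal.mem_comap]
    exact (incl_mem_maximalIdeal_iff h₁.dominates x).mpr hxm
  -- `W ≤ Q`: else `W R₁ = ⊤` and `J R₁` would be principal
  set W := weakTransformChart (K := K) x y J r with hWdef
  have hWQ : W ≤ Q := by
    by_contra hnot
    obtain ⟨w, hwW, hwQ⟩ := Set.not_subset.mp hnot
    apply hbad
    rw [isPrincipal_extIdeal_iff hm hx0 hJ hle]
    have htop : W.map (Subring.inclusion hle) = ⊤ := by
      refine Ideal.eq_top_of_isUnit_mem _ (Ideal.mem_map_of_mem _ hwW) ?_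
      have hw' : Subring.inclusion hle w ∉ maximalIdeal R₁ := fun h => hwQ (Ideal.mem_comap.mpr h)
      exact IsLocalRing.notMem_maximalIdeal.mp hw'
    rw [htop]
    exact ⟨⟨1, by simp⟩⟩
  -- `Q` is minimal over `W + xA`
  have hWx : ¬ W ≤ Ideal.span {chartIncl (K := K) x y x} :=
    weakTransform_not_le_span hdim hm hx0 hJ hJr
  refine ⟨Q, ⟨⟨inferInstance, sup_le hWQ h𝔭Q⟩, fun P ⟨hP, hIP⟩ hPQ => ?_⟩, inferInstance, hR₁⟩
  haveI := hP
  have h𝔭P : Ideal.span {chartIncl (K := K) x y x} < P := by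
    refine lt_of_le_of_ne (le_sup_right.trans hIP) fun heq => hWx ?_
    rw [heq]; exact le_sup_left.trans hIP
  exact (eq_of_span_lt_of_le hdim hx0 h𝔭 h𝔭P hPQ).ge

/-- **Only finitely many quadratic transforms of `R` are base points of `J`** (Zariski–Samuel II,
App. 5: the base points of an ideal on the first blowing up are finitely many closed points of
the exceptional curve): for a two-dimensional regular local ring `(R, 𝔪 = (x, y))` of `K` and an
ideal `J` of order exactly `r`, the set of quadratic transforms `R₁` of `R` with `J R₁` not
principal is finite — each lies in the chart of `x` or of `y` and is there the local ring at a
minimal prime over `(JA : x^r) + xA` (resp. with `y`), of which a Noetherian ring has finitely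
many. [cite: ZariskiSamuel1960, Appendix 5] -/
theorem finite_setOf_isQuadraticTransform_not_isPrincipal (hdim : ringKrullDim R = 2)
    (hm : maximalIdeal R = Ideal.span {x, y}) (hx0 : x ≠ 0) (hy0 : y ≠ 0)
    (hpq : ∀ t, x ∣ y * t → x ∣ t) (hqp : ∀ t, y ∣ x * t → y ∣ t)
    {J : Ideal R} {r : ℕ} (hJ : J ≤ maximalIdeal R ^ r) (hJr : ¬ J ≤ maximalIdeal R ^ (r + 1)) :
    {R₁ : Subring K | IsQuadraticTransform R R₁ ∧ ¬ (extIdeal J R₁).IsPrincipal}.Finite := by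
  classical
  have hm' : maximalIdeal R = Ideal.span {y, x} := by rw [hm, Set.pair_comm]
  -- the candidate local rings in the two charts
  let fx : Ideal (chartAdjoin (K := K) x y) → Subring K := fun Q =>
    if h : Q.IsPrime then (@LocalSubring.ofPrime K _ (chartAdjoin (K := K) x y) Q h).toSubring else ⊥
  let fy : Ideal (chartAdjoin (K := K) y x) → Subring K := fun Q =>
    if h : Q.IsPrime then (@LocalSubring.ofPrime K _ (chartAdjoin (K := K) y x) Q h).toSubring else ⊥
  haveI : IsNoetherianRing (chartAdjoin (K := K) x y) := isNoetherianRing_adjoin_toSubring R _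
  haveI : IsNoetherianRing (chartAdjoin (K := K) y x) := isNoetherianRing_adjoin_toSubring R _
  have hfinx := (Ideal.finite_minimalPrimes_of_isNoetherianRing _
    (weakTransformChart (K := K) x y J r ⊔ Ideal.span {chartIncl x y x})).image fx
  have hfiny := (Ideal.finite_minimalPrimes_of_isNoetherianRing _
    (weakTransformChart (K := K) y x J r ⊔ Ideal.span {chartIncl y x y})).image fy
  refine (hfinx.union hfiny).subset ?_
  rintro R₁ ⟨h₁, hbad⟩
  haveI := h₁.isLocalRing
  rcases h₁.blowupRing_le_or hm with hX | hY
  · left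
    have hle : chartAdjoin (K := K) x y ≤ R₁ := (blowupRing_eq_adjoin (K := K) hm).symm.le.trans hX
    obtain ⟨Q, hQmin, hQp, hR₁⟩ :=
      exists_minimalPrime_of_not_isPrincipal hdim hm hx0 hpq hJ hJr h₁ hle hbad
    refine ⟨Q, hQmin, ?_⟩
    simp only [fx, dif_pos hQp]
    exact hR₁.symm
  · right
    have hle : chartAdjoin (K := K) y x ≤ R₁ := (blowupRing_eq_adjoin (K := K) hm').symm.le.trans hY
    obtain ⟨Q, hQmin, hQp, hR₁⟩ :=
      exists_minimalPrime_of_not_isPrincipal hdim hm' hy0 hqp hJ hJr h₁ hle hbad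
    refine ⟨Q, hQmin, ?_⟩
    simp only [fy, dif_pos hQp]
    exact hR₁.symm

end Finite

/-! ## The colength drops at a first quadratic transform -/

section Colength

variable {R : Subring K} [IsRegularLocalRing R] {x y : R}

/-- **At a quadratic transform in the chart of `x` the colength of the weak transform drops**
(Huneke–Swanson Lemma 14.3.4, `length_quotient_transform_lt_of_not_mem`, followed by localisation,
`length_quotient_map_le_of_isLocalization`): if `J ⊆ 𝔪^r` (`r ≥ 1`) has finite colength and
contains an `f` with `f ∉ (x) + 𝔪^{r+1}`, then for every prime `Q` of `A = R[y/x]`,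
`λ_{A_Q}(A_Q/(JA : x^r)A_Q) < λ_R(R/J)`. [cite: HunekeSwanson2006, Lemma 14.3.4] -/
theorem length_quotient_weakTransform_map_lt (hdim : ringKrullDim R = 2)
    (hm : maximalIdeal R = Ideal.span {x, y}) (hx0 : x ≠ 0) {J : Ideal R} {r : ℕ} (hr : 1 ≤ r)
    (hJ : J ≤ maximalIdeal R ^ r) {f : R} (hfJ : f ∈ J)
    (hf : f ∉ Ideal.span {x} ⊔ maximalIdeal R ^ (r + 1)) (hfin : IsFiniteLength R (R ⧸ J))
    (Q : Ideal (chartAdjoin (K := K) x y)) [Q.IsPrime] :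
    Module.length (LocalSubring.ofPrime (chartAdjoin (K := K) x y) Q).toSubring
        ((LocalSubring.ofPrime (chartAdjoin (K := K) x y) Q).toSubring ⧸
          (weakTransformChart x y J r).map
            (algebraMap (chartAdjoin (K := K) x y)
              (LocalSubring.ofPrime (chartAdjoin (K := K) x y) Q).toSubring)) <
      Module.length R (R ⧸ J) := by
  letI : Algebra R (chartAdjoin (K := K) x y) := (chartIncl x y).toAlgebra
  have halg : algebraMap R (chartAdjoin (K := K) x y) = chartIncl x y := rfl
  haveI := isDomain_of_isRegularLocalRing R
  have hxm : x ∈ maximalIdeal R := hm ▸ Ideal.subset_span (by simp)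
  have hx2 := fst_not_mem_sq hdim hm
  have hx0K : ((x : R) : K) ≠ 0 := fun e => hx0 (Subtype.ext e)
  have hinj : Function.Injective (algebraMap R (chartAdjoin (K := K) x y)) := chartIncl_injective x y
  have hxS : algebraMap R (chartAdjoin (K := K) x y) x ∈ nonZeroDivisors _ := by
    apply mem_nonZeroDivisors_of_ne_zero
    intro h0
    exact hx0K (congrArg (fun s : chartAdjoin (K := K) x y => (s : K)) h0)
  have hmS : (maximalIdeal R).map (algebraMap R (chartAdjoin (K := K) x y)) =
      Ideal.span {algebraMap R _ x} := map_maximalIdeal_chartIncl hm hx0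
  have hS2 := exists_pow_mul_eq_chartIncl (K := K) hm hx0
  have h1 := length_quotient_transform_lt_of_not_mem (S := chartAdjoin (K := K) x y) hxm hx2 hinj
    hxS hmS hS2 hm.symm hr hJ hfJ hf hfin
  exact (length_quotient_map_le_of_isLocalization Q _).trans_lt h1

end Colength

end Literature.AlgebraicGeometry.Resolution

end
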